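import Mathlib
import Summits.NavierStokesRegularity.NavierStokesRegularity.Theorems.EulerZoomLiouvillePowerGaugeEulerLiouvilleSelfSimilarVorticityTransport
import Summits.NavierStokesRegularity.NavierStokesRegularity.Theorems.EulerZoomLiouvillePowerGaugeEulerLiouvilleSelfSimilarNodalCone
import Summits.NavierStokesRegularity.NavierStokesRegularity.Theorems.EulerZoomLiouvillePowerGaugeEulerLiouvilleSelfSimilarBackwardTrajectories
import Literature.Analysis.FluidPDE.SelfSimilarEulerStagnationStretching
import HarnessLib.Audit

/-!
# Rung C1 of the crux `EulerZoomLiouville.PowerGaugeEulerLiouville`: the NODAL-FINITENESS EXCLUSION —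
# an in-window self-similar Euler profile with finitely many (certified) stagnation points is trivial

Route №10 `EulerZoomLiouville` (NavierStokesRegularity), crux E = stmt-NavierStokesRegularity-19832,
tenure rung C1 (exactly self-similar members), registered residue `stub_selfSimilarExtremal`.
Fourth file of the NODAL-FINITENESS chain (lineage ns-typeII-p2, gen 6): the Baire-category assembly.

SETTING. `(U, P)` a `C²` self-similar Euler profile (CIV 2026 (3.3)) with exponent `0 < γ < ½` and the
far-field bounds (3.8); `V = γ(y−c) + U`, `Ω = curl U`, nodal set `𝒩_V = {V = 0}` (compact, contains
`c`).  A node `z` is CERTIFIED if `M = DV(z) = γI + DU(z)` carries one of: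

* a KILL certificate — a coercive bilinear form `B` and `β' < 1 + γ` with
  `B(Mv,v) + B(v,Mv) ≤ 2β'B(v,v)` (exists iff `maxRe spec DU(z) < 1`); or
* a THIN certificate — a bilinear form `Q`, a vector `e` with `Q(e,e) > 0`, and `η > 0`, `θ ≤ 0` with
  `Q(Mv,v) + Q(v,Mv) ≤ 2θQ(v,v) − η‖v‖²` (exists iff `DV(z)` has an eigenvalue of negative real part).

Since `tr DV(z) = 3γ < 1 + γ`, EVERY real `3 × 3` matrix in question carries one of the two (if
`maxRe spec ≥ 1+γ` the two remaining real parts sum to `≤ 2γ − 1 < 0`); the linear algebra producing the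
certificate is supplied separately (`…SelfSimilarNodeCertificates`: non-vortical nodes, where
`DU(z)` is symmetric, via the spectral theorem; vortical nodes, where `DV(z)Ω(z) = (1+γ)Ω(z)`, are the
remaining case).

* `interior_backwardTrapped_from_eq_empty` — transport of the cone lemma along the flow: the set of
  points whose backward orbit stays `δ`-close to `z` from time `T` on has empty interior too.
* `curl_eq_zero_of_finite_nodalSet_of_certificates` — **MAIN THEOREM (vorticity form): if `𝒩_V` is
  finite and every node is certified, then `curl U ≡ 0`.**  Proof: every backward trajectory converges
  to a node (`exists_tendsto_backward_orbit`); a point carrying vorticity cannot converge to a KILL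
  node (`curl_comp_eq_zero_of_tendsto_of_lowerCertificate`), so it lies in one of the countably many
  CLOSED sets `C_{z,n} = {x : Φ_{−t}x ∈ B̄(z,δ_z) ∀ t ≥ n}` attached to THIN nodes, each with EMPTY
  INTERIOR (cone lemma); with the closed set `{Ω = 0}` they cover `ℝ³`, so by BAIRE the interior of
  `{Ω = 0}` is dense, i.e. `Ω ≡ 0`.
* `eq_zero_of_finite_nodalSet_of_certificates` — **velocity form: `U ≡ 0`** (harmonic Liouville step of
  the lineage, `eq_of_curl_eq_zero_of_isDivFree_of_fderiv_tendsto_zero`, and `U(c) = 0`).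

READING (rung C1 portrait): a nontrivial classical in-window profile with CIV's far field has
INFINITELY MANY stagnation points, or a stagnation point whose linearisation is uncertified (with the
certificate lemma: none).  CIV Thm 3.10 assumed finitely many nodes AND the outgoing inequality AND
analyticity; here finiteness alone (plus linear algebra at each node) suffices.

WHAT THIS IS NOT: not NS, not E, not rung C1 — classical (`C²`) profiles with the far field (3.8)
only; the weak-class residue and profiles with infinite nodal sets are untouched.

## References

* P. Constantin, M. Ignatova, V. Vicol, arXiv:2602.17570 (2026), §3.5 Def 3.7, Thms 3.8–3.10.
  [ConstantinIgnatovaVicol2026Putative]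
* A. Katok, B. Hasselblatt, CUP 1995, §6.2 (cone criterion). [KatokHasselblatt1995]
-/

noncomputable section

-- flat `Theorems/<Route><Decl>…` files of one crux share the namespace of the crux (tree convention)
set_option linter.dupNamespace false

open Set Filter Topology Metric Function InnerProductSpace
open scoped RealInnerProductSpace NNReal

namespace Summit.NavierStokesRegularity.NavierStokesRegularity.Theorems.PowerGaugeEulerLiouville.NodalFiniteness

open Literature.Analysis Literature.Analysis.FluidPDE Literature.Analysis.ODE

variable {γ C : ℝ} {c : EuclideanSpace ℝ (Fin 3)}
  {U : EuclideanSpace ℝ (Fin 3) → EuclideanSpace ℝ (Fin 3)} {P : EuclideanSpace ℝ (Fin 3) → ℝ}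

/-! ### Transport of the cone lemma along the flow -/

/-- If the backward-trapped set `Λ_δ(z) = {x : Φ_{−t}x ∈ B̄(z,δ) ∀ t ≥ 0}` has empty interior, so has
`{x : Φ_{−t}x ∈ B̄(z,δ) ∀ t ≥ T}` for every `T` (it is the preimage of `Λ_δ(z)` under the homeomorphism
`Φ_{−T}`; we only use continuity of `Φ_T` and the group law). [folklore] -/
theorem interior_backwardTrapped_from_eq_empty (h : IsSelfSimilarEulerProfile γ c U P) {K : ℝ≥0}
    (hK : LipschitzWith K (selfSimilarTransport γ c U)) (z : EuclideanSpace ℝ (Fin 3)) (δ : ℝ)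
    (hΛ : interior {x : EuclideanSpace ℝ (Fin 3) |
      ∀ t, 0 ≤ t → lipschitzFlow hK x (-t) ∈ closedBall z δ} = ∅) (T : ℝ) :
    interior {x : EuclideanSpace ℝ (Fin 3) |
      ∀ t, T ≤ t → lipschitzFlow hK x (-t) ∈ closedBall z δ} = ∅ := by
  rw [eq_empty_iff_forall_notMem]
  intro x₀ hx₀
  rw [mem_interior_iff_mem_nhds, Metric.mem_nhds_iff] at hx₀
  obtain ⟨r, hr, hball⟩ := hx₀
  -- `ψ y = Φ_T y` is continuous and `ψ (Φ_{-T} x₀) = x₀`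
  set ψ : EuclideanSpace ℝ (Fin 3) → EuclideanSpace ℝ (Fin 3) := fun y => lipschitzFlow hK y T with hψ
  have hψc : Continuous ψ := continuous_flow_slice h hK T
  set y₀ := lipschitzFlow hK x₀ (-T) with hy₀
  have hψy₀ : ψ y₀ = x₀ := by
    simp only [hψ, hy₀]
    rw [← lipschitzFlow_add, neg_add_cancel, lipschitzFlow_zero]
  set W : Set (EuclideanSpace ℝ (Fin 3)) := ψ ⁻¹' ball x₀ r with hW
  have hWo : IsOpen W := isOpen_ball.preimage hψc
  have hy₀W : y₀ ∈ W := by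
    show ψ y₀ ∈ ball x₀ r
    rw [hψy₀]; exact mem_ball_self hr
  -- `W ⊆ Λ_δ(z)`
  have hWΛ : W ⊆ {x : EuclideanSpace ℝ (Fin 3) |
      ∀ t, 0 ≤ t → lipschitzFlow hK x (-t) ∈ closedBall z δ} := by
    intro y hy s hs
    have hyC := hball hy   -- `ψ y` is trapped from time `T`
    have h1 := hyC (s + T) (by linarith)
    -- `Φ_{-(s+T)} (Φ_T y) = Φ_{-s} y`
    have e : lipschitzFlow hK (ψ y) (-(s + T)) = lipschitzFlow hK y (-s) := by
      simp only [hψ]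
      rw [← lipschitzFlow_add]
      congr 1; ring
    rw [e] at h1
    exact h1
  have : y₀ ∈ interior {x : EuclideanSpace ℝ (Fin 3) |
      ∀ t, 0 ≤ t → lipschitzFlow hK x (-t) ∈ closedBall z δ} :=
    mem_interior.2 ⟨W, hWΛ, hWo, hy₀W⟩
  rw [hΛ] at this
  exact this

/-! ### The main theorem -/

/-- **NODAL-FINITENESS EXCLUSION, vorticity form.**  Let `0 < γ < ½` and let `(U, P)` be a `C²`
self-similar Euler profile (CIV (3.3)) with the far-field bounds (3.8).  Suppose the nodal set
`𝒩_V` of `V = γ(y−c) + U` is FINITE and every node `z` is certified: `DV(z)` carries either a KILL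
certificate (coercive `B`, `β' < 1+γ`, `B(DV(z)v,v) + B(v,DV(z)v) ≤ 2β'B(v,v)`) or a THIN certificate
(`Q` with `Q(e,e) > 0`, `η > 0`, `θ ≤ 0`, `Q(DV(z)v,v) + Q(v,DV(z)v) ≤ 2θQ(v,v) − η‖v‖²`).  Then
`curl U = 0`.  Baire-category proof: backward trajectories converge to nodes; vorticity-carrying points
cannot converge to KILL nodes; the points converging to a THIN node form a countable union of closed
sets with empty interior; so `{curl U = 0}` (closed) has dense interior.
[cite: ConstantinIgnatovaVicol2026Putative, §3.5 Thm 3.10 (finite nodal set; here without the outgoing inequality and without analyticity)] -/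
theorem curl_eq_zero_of_finite_nodalSet_of_certificates (h : IsSelfSimilarEulerProfile γ c U P)
    (hγ : 0 < γ) (hγ2 : γ < 1 / 2) (hfar : HasSelfSimilarFarFieldWith γ c C U)
    (hfin : (selfSimilarNodalSet γ c U).Finite)
    (hcert : ∀ z ∈ selfSimilarNodalSet γ c U,
      (∃ (B : EuclideanSpace ℝ (Fin 3) →L[ℝ] EuclideanSpace ℝ (Fin 3) →L[ℝ] ℝ) (cB β' : ℝ),
        0 < cB ∧ β' < 1 + γ ∧ (∀ v, cB * ‖v‖ ^ 2 ≤ B v v) ∧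
        ∀ v, B (fderiv ℝ (selfSimilarTransport γ c U) z v) v +
          B v (fderiv ℝ (selfSimilarTransport γ c U) z v) ≤ 2 * β' * B v v) ∨
      (∃ (Q : EuclideanSpace ℝ (Fin 3) →L[ℝ] EuclideanSpace ℝ (Fin 3) →L[ℝ] ℝ) (η θ : ℝ)
        (e : EuclideanSpace ℝ (Fin 3)), 0 < η ∧ θ ≤ 0 ∧ 0 < Q e e ∧
        ∀ v, Q (fderiv ℝ (selfSimilarTransport γ c U) z v) v +
          Q v (fderiv ℝ (selfSimilarTransport γ c U) z v) ≤ 2 * θ * Q v v - η * ‖v‖ ^ 2)) :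
    curl U = 0 := by
  classical
  set V := selfSimilarTransport γ c U with hV
  set N := selfSimilarNodalSet γ c U with hN
  have hγ' : γ ≠ 1 / 2 := hγ2.ne
  have hK := lipschitzWith_transport h hγ hfar
  -- the KILL predicate and the THIN data at non-KILL nodes
  set Kill : EuclideanSpace ℝ (Fin 3) → Prop := fun z =>
    ∃ (B : EuclideanSpace ℝ (Fin 3) →L[ℝ] EuclideanSpace ℝ (Fin 3) →L[ℝ] ℝ) (cB β' : ℝ),
      0 < cB ∧ β' < 1 + γ ∧ (∀ v, cB * ‖v‖ ^ 2 ≤ B v v) ∧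
      ∀ v, B (fderiv ℝ V z v) v + B v (fderiv ℝ V z v) ≤ 2 * β' * B v v with hKill
  have hthin : ∀ z, z ∈ N → ¬ Kill z → ∃ δ : ℝ, 0 < δ ∧
      interior {x : EuclideanSpace ℝ (Fin 3) |
        ∀ t, 0 ≤ t → lipschitzFlow hK x (-t) ∈ closedBall z δ} = ∅ := by
    intro z hz hk
    rcases hcert z hz with hk' | ⟨Q, η, θ, e, hη, hθ, he, hc⟩
    · exact absurd hk' hk
    · obtain ⟨δ, hδ, hint⟩ := interior_backwardTrapped_eq_empty h hK z Q hη hθ hc he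
      exact ⟨δ, hδ, hint⟩
  choose! δ hδpos hδint using hthin
  -- the countable closed cover
  haveI : Finite N := hfin.to_subtype
  set Z : Set (EuclideanSpace ℝ (Fin 3)) := {x | curl U x = 0} with hZ
  set S : Option (N × ℕ) → Set (EuclideanSpace ℝ (Fin 3)) := fun i =>
    i.elim Z fun p => if Kill (p.1 : EuclideanSpace ℝ (Fin 3)) then ∅ else
      {x | ∀ t, (p.2 : ℝ) ≤ t → lipschitzFlow hK x (-t) ∈ closedBall (p.1 : EuclideanSpace ℝ (Fin 3))
        (δ p.1)} with hS
  have hcurlc : Continuous (curl U) := h.isSelfSimilarEulerVorticityProfile.differentiable_curl.continuous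
  have hZc : IsClosed Z := isClosed_eq hcurlc continuous_const
  have hSc : ∀ i, IsClosed (S i) := by
    rintro (_ | ⟨z, n⟩)
    · exact hZc
    · simp only [hS, Option.elim]
      split_ifs
      · exact isClosed_empty
      · exact isClosed_backwardTrapped h hK _ _ _
  have hSint : ∀ p : N × ℕ, interior (S (some p)) = ∅ := by
    rintro ⟨z, n⟩
    simp only [hS, Option.elim]
    split_ifs with hk
    · exact interior_empty
    · exact interior_backwardTrapped_from_eq_empty h hK _ _ (hδint z z.2 hk) _
  -- the cover property
  have hcover : ⋃ i, S i = univ := by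
    rw [eq_univ_iff_forall]
    intro x
    rw [mem_iUnion]
    by_cases hx : curl U x = 0
    · exact ⟨none, hx⟩
    -- the backward orbit of `x` converges to a node `z`
    obtain ⟨z, hzN, hz⟩ := exists_tendsto_backward_orbit h hγ hγ' hfar hfin hK x
    by_cases hk : Kill z
    · -- KILL node: the trajectory carries no vorticity — contradiction
      obtain ⟨B, cB, β', hcB, hβ', hB, hc⟩ := hk
      have h0 := curl_comp_eq_zero_of_tendsto_of_lowerCertificate h
        (norm_curl_le_of_farField hγ hfar) (norm_fderiv_le_of_farField hγ hfar)
        (hasDerivAt_backwardFlow hK x) hz B hcB hB hβ' hc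
      simp only [neg_zero, lipschitzFlow_zero] at h0
      exact absurd h0 hx
    · -- THIN node: `x` is trapped near `z` from some integer time on
      have hδz := hδpos z hzN hk
      have hev : ∀ᶠ t in atTop, dist (lipschitzFlow hK x (-t)) z < δ z :=
        Metric.tendsto_nhds.1 hz _ hδz
      obtain ⟨T₀, hT₀⟩ := hev.exists_forall_of_atTop
      obtain ⟨n, hn⟩ := exists_nat_ge T₀
      refine ⟨some (⟨z, hzN⟩, n), ?_⟩
      simp only [hS, Option.elim, if_neg hk]
      intro t ht
      exact mem_closedBall.2 (hT₀ t (hn.trans ht)).le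
  -- Baire
  have hdense := dense_iUnion_interior_of_closed hSc hcover
  have hsub : (⋃ i, interior (S i)) ⊆ interior Z := by
    intro x hx
    rw [mem_iUnion] at hx
    obtain ⟨i, hi⟩ := hx
    rcases i with _ | p
    · exact hi
    · rw [hSint p] at hi; exact hi.elim
  have hZd : Dense (interior Z) := hdense.mono hsub
  have hZuniv : Z = univ := by
    apply eq_univ_of_univ_subset
    rw [← hZd.closure_eq]
    exact (closure_mono interior_subset).trans hZc.closure_subset
  funext x
  have : x ∈ Z := hZuniv ▸ mem_univ x
  exact this

/-- **NODAL-FINITENESS EXCLUSION, velocity form: `U ≡ 0`.**  Under the hypotheses of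
`curl_eq_zero_of_finite_nodalSet_of_certificates` the profile is trivial: `curl U = 0`, `div U = 0` and
`DU → 0` at infinity ((3.8)) make `U` constant (`eq_of_curl_eq_zero_of_isDivFree_of_fderiv_tendsto_zero`),
and `U(c) = 0`.  Reading: a NONTRIVIAL classical in-window profile with CIV's far field has infinitely
many stagnation points or an uncertified one.
[cite: ConstantinIgnatovaVicol2026Putative, §3.5 Thm 3.10 (finite nodal set; here without the outgoing inequality and without analyticity)] -/
theorem eq_zero_of_finite_nodalSet_of_certificates (h : IsSelfSimilarEulerProfile γ c U P)
    (hγ : 0 < γ) (hγ2 : γ < 1 / 2) (hfar : HasSelfSimilarFarFieldWith γ c C U)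
    (hfin : (selfSimilarNodalSet γ c U).Finite)
    (hcert : ∀ z ∈ selfSimilarNodalSet γ c U,
      (∃ (B : EuclideanSpace ℝ (Fin 3) →L[ℝ] EuclideanSpace ℝ (Fin 3) →L[ℝ] ℝ) (cB β' : ℝ),
        0 < cB ∧ β' < 1 + γ ∧ (∀ v, cB * ‖v‖ ^ 2 ≤ B v v) ∧
        ∀ v, B (fderiv ℝ (selfSimilarTransport γ c U) z v) v +
          B v (fderiv ℝ (selfSimilarTransport γ c U) z v) ≤ 2 * β' * B v v) ∨
      (∃ (Q : EuclideanSpace ℝ (Fin 3) →L[ℝ] EuclideanSpace ℝ (Fin 3) →L[ℝ] ℝ) (η θ : ℝ)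
        (e : EuclideanSpace ℝ (Fin 3)), 0 < η ∧ θ ≤ 0 ∧ 0 < Q e e ∧
        ∀ v, Q (fderiv ℝ (selfSimilarTransport γ c U) z v) v +
          Q v (fderiv ℝ (selfSimilarTransport γ c U) z v) ≤ 2 * θ * Q v v - η * ‖v‖ ^ 2)) :
    U = 0 := by
  have hcurl0 := curl_eq_zero_of_finite_nodalSet_of_certificates h hγ hγ2 hfar hfin hcert
  have hcurl : ∀ x, curl U x = 0 := fun x => congrFun hcurl0 x
  have hD := hfar.tendsto_norm_fderiv hγ
  funext y
  rw [eq_of_curl_eq_zero_of_isDivFree_of_fderiv_tendsto_zero h.contDiff_velocity hcurl h.divFree hD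
    y c, hfar.apply_center]
  rfl

end Summit.NavierStokesRegularity.NavierStokesRegularity.Theorems.PowerGaugeEulerLiouville.NodalFiniteness
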